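/-
Copyright (c) 2026 the pub-hodgecm-mathlib formalisation cell (harness21).  Prover seat hodgecm-mathlib-K2E1-p15 (g3), Track B ∕ K2-LIT, h413 = `stmt-HodgeConjecture-24833`,
R90-TF section S8 «ContSpec-n½» (planner R90-CS-plan (g0), file (a) of the R2-χ-local census `R90/S8/CENSUS-R2chi-local.K2E1-p13-g3.md`, cut (α) 2026-09-04T16:11:02Z): J1a-arith —
E1's unramified local `χ`-scalar of `U(J₂)` at `z` IS K2Liu's rank-one Gindikin–Karpelevich scalar `aNorm 1 χ_v vol (z − ½)` (up to the Haar volume), via the J1a dictionary.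
-/
import Summits.HodgeConjecture.HodgeConjecture.Theorems.K2LiuGKRankOneIdentityLFactor              -- ★ (K2Liu) `localIntertwining_eq_aNorm_one_mul_of_re_pos`, `rankOne_scalar_eq`, `unramValue_chiF_eq_prod`; brings ★ T1 `K2LiuLocalLFactorDefs` (`chiF`, `unramValue`, `lF`, `lFactor_def`, `aNorm_one`, `unifAt`)
import Summits.HodgeConjecture.HodgeConjecture.Theorems.K2E1HeckeCharBaseChangeLocalComponentsU      -- ★ p861797 (this seat, J1a-dict): `valueAtUniformizer_eq_prod_of_comp_ideleBaseChange`
import Summits.HodgeConjecture.HodgeConjecture.Theorems.K2E1ChiIntertwiningScalarEulerQuotientU2     -- ★ p861632 (K2E1-p13): the E1 token `(1 − ε_v q_v^{−2z})(1 − ε_v q_v^{−(2z−1)})⁻¹` of `hasProd_chiLocalScalar`; brings `residueCard`, `partialStandardL`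
import HarnessLib

/-!
# J1a-arith — `K2E1ChiIntertwiningLocalScalarFromK2LiuU2`: at an unramified place `v`, E1's local `χ`-scalar `(1 − ε(ϖ_v)q_v^{−2z})·(1 − ε(ϖ_v)q_v^{−(2z−1)})⁻¹` (`ε = χ|_{𝕀_F}`) EQUALS
# K2Liu's `L_v(2s, χ_F)∕L_v(2s+1, χ_F) = aNorm 1 χ_v vol s ∕ vol` at `s = z − ½`; hence the rank-one local intertwining operator acts on the spherical vector by E1's scalar

Track B ∕ K2-LIT, crux h413 = `stmt-HodgeConjecture-24833`, route of record `HCCMUnconditional`; cell `hodgecm-mathlib`, R90-TF programme, section S8 «ContSpec-n½», socket #4 road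
(R2-χ-local, junction J1 between the E1 estate — ★ `K2E1ChiIntertwiningScalarEulerQuotientU2`, normalisation `z`, GLOBAL `ε : HeckeCharacter L⁺` — and the K2Liu rank-one doubling estate —
★ `K2LiuGKRankOneIdentityLFactor`, normalisation `s = z − ½`, LOCAL `χ_v = (χ_w)_{w∣v}`).  THEOREMS ONLY (no `def`, no `instance`, no `notation`, no named-fact hypothesis, no `sorry`;
default heartbeats); lane `--supports stmt-HodgeConjecture-24833 --as helper` (count-neutral).  GENERIC quadratic `E∕F` where K2Liu is (§1–§2 need no `IsQuadraticExtension`).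

THE MATHEMATICS ([HarrisKudlaSweet1996, §6 (6.14)–(6.16)]; [Casselman1980, §3 Thm. 3.1]; [Rogawski1990, §13.9 p. 229]; [TateThesis1967, §4.3]).  Let `χ` be a Hecke character of `E`,
`ε` a Hecke character of `F` with `χ ∘ (base change) = ε` («`ε = χ|_{𝕀_F} = χ₀`»), `v` a finite place of `F` with `χ_w` unramified for all `w ∣ v`, `q_v = N(v)`.  §1 (closed form):
`L_v(2s, χ_F)∕L_v(2s+1, χ_F) = (1 − α q_v^{−(2s+1)})·(1 − α q_v^{−2s})⁻¹`, `α = unramValue (chiF χ_v)` (★ T1 `lFactor_def`).  §2 (THE JUNCTION): by J1a-dict (★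
`valueAtUniformizer_eq_prod_of_comp_ideleBaseChange`) and ★ `unramValue_chiF_eq_prod`, `α = ε(ϖ_v) = ε.valueAtUniformizer v`, and `residueFieldCard F_v = N(v) = v.residueCard` (★
`residueFieldCard_adicCompletion_eq_absNorm`); with `s = z − ½` (`2s = 2z − 1`, `2s + 1 = 2z`) E1's token of ★ `hasProd_chiLocalScalar` IS `L_v(2s,χ_F)∕L_v(2s+1,χ_F)`, i.e. `vol⁻¹ · aNorm 1
χ_v vol s` (★ `aNorm_one`).  §3 (operator level): ★ `localIntertwining_eq_aNorm_one_mul_of_re_pos` (rank-one Gindikin–Karpelevich, `M_v φ = aNorm·φ′` for `0 < Re s`) read through §2: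
for `½ < Re z` the local intertwining operator of the doubled rank-one group acts on the `χ_v`-spherical section by `νN(N_Δ ∩ K_v) · (1 − ε(ϖ_v)q_v^{−2z})(1 − ε(ϖ_v)q_v^{−(2z−1)})⁻¹` —
E1's unramified local `χ`-scalar at `z`, the value J2 multiplies over `v ∉ S` against ★ p861632's Euler product `L^S(2z−1, ε)∕L^S(2z, ε)`.
* §1 `lF_two_mul_div_lF_two_mul_add_one` — closed form of K2Liu's ratio.
* §2 **`chiLocalScalar_eq_lF_div`**, **`chiLocalScalar_eq_aNorm_one_div_vol`** — THE JUNCTION HEADS (E1 token `=` K2Liu scalar at `s = z − ½`).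
* §3 **`localIntertwining_eq_chiLocalScalar_mul`** — the rank-one local intertwining operator in E1's scalar currency (binders of ★ `localIntertwining_eq_aNorm_one_mul_of_re_pos` verbatim).
HONEST LABEL: HC_CM is proved only modulo the 7 printed citations (2 remaining named inputs: hLiu418 = `stmt-HodgeConjecture-24832`, h413 = `stmt-HodgeConjecture-24833`) until
rung 0 closes; this file asserts no named fact and closes no socket; count-neutral.

## References
* [HarrisKudlaSweet1996] M. Harris, S. Kudla, W. J. Sweet, *Theta dichotomy for unitary groups*, J. AMS 9 (1996), §6 (6.14)–(6.16).
* [Casselman1980] W. Casselman, *The unramified principal series of p-adic groups I*, Compositio Math. 40 (1980), §3 Thm. 3.1.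
* [Rogawski1990] J. Rogawski, *Automorphic Representations of Unitary Groups in Three Variables* (1990), §13.9 p. 229 (`M(s)` at `N = 2`).
* [TateThesis1967] J. Tate, *Fourier analysis in number fields and Hecke's zeta-functions*, in Cassels–Fröhlich (1967), §4.3.
-/

set_option autoImplicit false
set_option linter.dupNamespace false  -- the mandated namespace repeats the summit's segment (`HodgeConjecture.HodgeConjecture`)

noncomputable section

open NumberField IsDedekindDomain Matrix MeasureTheory
open Literature.NumberTheory.GaloisRepresentations.IsNonarchimedeanLocalField
open Literature.NumberTheory.Automorphic Literature.NumberTheory.Automorphic.UnitaryGroup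
open Literature.NumberTheory.GaloisRepresentations
open Literature.NumberTheory.GelbartRogawski1991.UnitaryDualPair.LocalSplitting
open Literature.NumberTheory.K2Lit.LocalSiegelDoubled
open Summit.HodgeConjecture.HodgeConjecture.Cruxes.HLiu418.K2LiuLocalLFactorDefs
open Summit.HodgeConjecture.HodgeConjecture.Cruxes.HLiu418.K2LiuGKRankOneIdentity
open Summit.HodgeConjecture.HodgeConjecture.Cruxes.HLiu418.K2LiuGKRankOneIdentityLFactor
open Summit.HodgeConjecture.HodgeConjecture.Cruxes.H413.K2E1HeckeCharBaseChangeLocalComponentsU (isUnramifiedAt_of_comp_ideleBaseChange valueAtUniformizer_eq_prod_of_comp_ideleBaseChange)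

namespace Summit.HodgeConjecture.HodgeConjecture.Cruxes.H413.K2E1ChiIntertwiningLocalScalarFromK2LiuU2

variable (F : Type) [Field F] [NumberField F] (E : Type) [Field E] [NumberField E] [Algebra F E]
  (v : HeightOneSpectrum (𝓞 F))

/-! ## §1 K2Liu's rank-one ratio in closed form -/

/-- **`L_v(2s, χ_F)∕L_v(2s+1, χ_F) = (1 − α q_v^{−(2s+1)})·(1 − α q_v^{−2s})⁻¹`**, `α = unramValue (chiF χ_v)`, `q_v = residueFieldCard F_v` (★ T1 `lFactor_def`, `inv_div_inv`).
[cite: HarrisKudlaSweet1996, §6 (6.16)] -/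
theorem lF_two_mul_div_lF_two_mul_add_one (χv : ∀ w : PlacesOver E v, (w.1.adicCompletion E)ˣ →* ℂˣ) (s : ℂ) :
    lF F E v χv (2 * s) / lF F E v χv (2 * s + 1) =
      (1 - unramValue F v (chiF F E v χv) * (residueFieldCard (v.adicCompletion F) : ℂ) ^ (-(2 * s + 1))) *
        (1 - unramValue F v (chiF F E v χv) * (residueFieldCard (v.adicCompletion F) : ℂ) ^ (-(2 * s)))⁻¹ := by
  rw [lF, lF, lFactor_def, lFactor_def, inv_div_inv, div_eq_mul_inv]

/-! ## §2 The junction: E1's token at `z` equals K2Liu's ratio at `s = z − ½` -/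

variable {F E} in
/-- **THE SATAKE VALUE IS `ε(ϖ_v)`**: for `ε = χ|_{𝕀_F}` (hypothesis-first) and `χ_w` unramified at every `w ∣ v`, `unramValue (chiF (fun w => χ_w)) = ε.valueAtUniformizer v` — ★ J1a-dict
`valueAtUniformizer_eq_prod_of_comp_ideleBaseChange` and ★ `unramValue_chiF_eq_prod` at the uniformizer `unifAt F v`. [cite: TateThesis1967, §4.3] [cite: HarrisKudlaSweet1996, §6 (6.16)] -/
theorem unramValue_chiF_localComponent_eq_valueAtUniformizer (χ : HeckeCharacter E) (ε : HeckeCharacter F)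
    (hε : ∀ a : ideleGroup F, χ (AdeleRing.ideleBaseChange F E a) = ε a)
    (hχ : ∀ (w : PlacesOver E v) (u : (w.1.adicCompletion E)ˣ), Valued.v (u : w.1.adicCompletion E) = 1 → χ.localComponent w.1 u = 1) :
    unramValue F v (chiF F E v (fun w => χ.localComponent w.1)) = ε.valueAtUniformizer v := by
  have hϖ0 : ∀ w : PlacesOver E v, toPlace v w (unifAt F v) ≠ 0 := fun w => (map_ne_zero (toPlace v w)).mpr (unifAt_ne_zero F v)
  rw [unramValue_chiF_eq_prod F E v (fun w => χ.localComponent w.1) hχ (valued_unifAt F v) hϖ0,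
    valueAtUniformizer_eq_prod_of_comp_ideleBaseChange χ ε hε v hχ (valued_unifAt F v) hϖ0]

variable {F E} in
/-- **THE JUNCTION — E1's local `χ`-scalar at `z` `=` K2Liu's `L_v(2s,χ_F)∕L_v(2s+1,χ_F)` at `s = z − ½`.**  For `ε = χ|_{𝕀_F}` and `χ_w` unramified at every `w ∣ v`:
`(1 − ε.valueAtUniformizer v · q_v^{−2z})·(1 − ε.valueAtUniformizer v · q_v^{−(2z−1)})⁻¹ = lF χ_v (2(z−½)) ∕ lF χ_v (2(z−½)+1)` with `χ_v := fun w => χ.localComponent w`, `q_v =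
v.residueCard` — the `v`-factor of ★ `K2E1ChiIntertwiningScalarEulerQuotientU2.hasProd_chiLocalScalar` IS the scalar of ★ `K2LiuGKRankOneIdentityLFactor.localIntertwining_eq_aNorm_one_mul`.
[cite: Rogawski1990, §13.9 p. 229] [cite: HarrisKudlaSweet1996, §6 (6.14)–(6.16)] [cite: Casselman1980, §3 Thm. 3.1] -/
theorem chiLocalScalar_eq_lF_div (χ : HeckeCharacter E) (ε : HeckeCharacter F)
    (hε : ∀ a : ideleGroup F, χ (AdeleRing.ideleBaseChange F E a) = ε a)
    (hχ : ∀ (w : PlacesOver E v) (u : (w.1.adicCompletion E)ˣ), Valued.v (u : w.1.adicCompletion E) = 1 → χ.localComponent w.1 u = 1) (z : ℂ) :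
    (1 - ε.valueAtUniformizer v * (v.residueCard : ℂ) ^ (-(2 * z))) * (1 - ε.valueAtUniformizer v * (v.residueCard : ℂ) ^ (-(2 * z - 1)))⁻¹ =
      lF F E v (fun w => χ.localComponent w.1) (2 * (z - 1 / 2)) / lF F E v (fun w => χ.localComponent w.1) (2 * (z - 1 / 2) + 1) := by
  have h1 : 2 * (z - 1 / 2) + 1 = 2 * z := by ring
  have h2 : 2 * (z - 1 / 2) = 2 * z - 1 := by ring
  have hq : (residueFieldCard (v.adicCompletion F) : ℂ) = (v.residueCard : ℂ) := by
    rw [residueFieldCard_adicCompletion_eq_absNorm]; rfl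
  rw [lF_two_mul_div_lF_two_mul_add_one, h1, h2, unramValue_chiF_localComponent_eq_valueAtUniformizer v χ ε hε hχ, hq]

variable {F E} in
/-- **… `= vol⁻¹ · aNorm 1 χ_v vol (z − ½)`** (★ T1 `aNorm_one`): E1's local `χ`-scalar at `z` is K2Liu's rank-one NORMALISER at `s = z − ½` divided by the Haar volume `vol = νN(N_Δ(F_v) ∩ K_v) ≠ 0`.
[cite: HarrisKudlaSweet1996, §6 (6.14)–(6.16)] -/
theorem chiLocalScalar_eq_aNorm_one_div_vol (c : E ≃ₐ[F] E) (χ : HeckeCharacter E) (ε : HeckeCharacter F)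
    (hε : ∀ a : ideleGroup F, χ (AdeleRing.ideleBaseChange F E a) = ε a)
    (hχ : ∀ (w : PlacesOver E v) (u : (w.1.adicCompletion E)ˣ), Valued.v (u : w.1.adicCompletion E) = 1 → χ.localComponent w.1 u = 1)
    {vol : ℝ} (hvol : vol ≠ 0) (z : ℂ) :
    (1 - ε.valueAtUniformizer v * (v.residueCard : ℂ) ^ (-(2 * z))) * (1 - ε.valueAtUniformizer v * (v.residueCard : ℂ) ^ (-(2 * z - 1)))⁻¹ =
      (vol : ℂ)⁻¹ * aNorm F E c v 1 (fun w => χ.localComponent w.1) vol (z - 1 / 2) := by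
  have hvolC : (vol : ℂ) ≠ 0 := Complex.ofReal_ne_zero.mpr hvol
  rw [chiLocalScalar_eq_lF_div v χ ε hε hχ z, aNorm_one, ← mul_assoc, inv_mul_cancel₀ hvolC, one_mul]

/-! ## §3 The rank-one local intertwining operator in E1's scalar currency -/

section Operator

variable [Algebra.IsQuadraticExtension F E] (c : E ≃ₐ[F] E)
  {δ : E} (hcδ : c δ = -δ) (hδ : δ ≠ 0) {d : F} (hd : δ * δ = algebraMap F E d)
  {T₀ : Matrix (Fin 1) (Fin 1) F} (hT₀ : T₀.IsSymm) (hT₀d : IsUnit T₀.det)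
  {JD : Matrix (Fin (1 + 1)) (Fin (1 + 1)) E} (hJD : JD = (gramD F 1 T₀).map (algebraMap F E))

include hT₀d in
/-- **THE LOCAL INTERTWINING OPERATOR ACTS ON THE `χ_v`-SPHERICAL SECTION BY E1's SCALAR** (`½ < Re z`): with the binders of ★ `localIntertwining_eq_aNorm_one_mul_of_re_pos` VERBATIM at
`s := z − ½` and `χv := fun w => χ.localComponent w` (`χ′_w = (χ_{w′})⁻¹ ∘ c_w`, unitary-size Satake value `‖∏_w χ_w(ι_w ϖ)‖ ≤ 1`), and `ε = χ|_{𝕀_F}`: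
`M_v φ (h) = νN(N_Δ ∩ K_v) · (1 − ε(ϖ_v)q_v^{−2z})·(1 − ε(ϖ_v)q_v^{−(2z−1)})⁻¹ · φ′(h)`. [cite: HarrisKudlaSweet1996, §6 (6.14)–(6.16)] [cite: Casselman1980, §3 Thm. 3.1]
[cite: Rogawski1990, §13.9 p. 229] -/
theorem localIntertwining_eq_chiLocalScalar_mul [MeasurableSpace (v.adicCompletion F)] [BorelSpace (v.adicCompletion F)]
    [MeasurableSpace (unipDeltaLocal F E c v 1 (JD := JD))] [BorelSpace (unipDeltaLocal F E c v 1 (JD := JD))]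
    (νN : Measure (unipDeltaLocal F E c v 1 (JD := JD))) [νN.IsHaarMeasure]
    (χ : HeckeCharacter E) (ε : HeckeCharacter F) (hε : ∀ a : ideleGroup F, χ (AdeleRing.ideleBaseChange F E a) = ε a)
    (χv' : ∀ w : PlacesOver E v, (w.1.adicCompletion E)ˣ →* ℂˣ)
    (hχ' : ∀ (w w' : PlacesOver E v) (h : c • w.1 = w'.1),
      χv' w = (χ.localComponent w'.1)⁻¹.comp (Units.map (galAdicCompletionMap (L := E) c h : w.1.adicCompletion E →* w'.1.adicCompletion E)))
    {z : ℂ} (hz : 1 / 2 < z.re) {φ φ' : UnitaryGroup.localPi E c (1 + 1) JD v → ℂ}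
    (hφ : IsSphericalSection F E c hcδ hδ hd v 1 hT₀ hJD (fun w => χ.localComponent w.1) (z - 1 / 2) φ)
    (hφ' : IsSphericalSection F E c hcδ hδ hd v 1 hT₀ hJD χv' (-(z - 1 / 2)) φ')
    (h2 : ∀ w : PlacesOver E v, ValuativeRel.valuation (w.1.adicCompletion E) (2 : w.1.adicCompletion E) = 1)
    (hT : ∀ (w : PlacesOver E v) (i j : Fin 1),
      ValuativeRel.valuation (w.1.adicCompletion E) (algebraMap E (w.1.adicCompletion E) (algebraMap F E (T₀ i j))) ≤ 1)
    (hTinv : ∀ (w : PlacesOver E v) (i j : Fin 1),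
      ValuativeRel.valuation (w.1.adicCompletion E) (algebraMap E (w.1.adicCompletion E) (algebraMap F E (T₀⁻¹ i j))) ≤ 1)
    (hδw : ∀ w : PlacesOver E v, Valued.v ((δ : E) : w.1.adicCompletion E) = 1)
    (hχ : ∀ (w : PlacesOver E v) (u : (w.1.adicCompletion E)ˣ), Valued.v (u : w.1.adicCompletion E) = 1 → χ.localComponent w.1 u = 1)
    {ϖ : v.adicCompletion F} (hϖ : Valued.v ϖ = WithZero.exp (-1 : ℤ)) (hϖ0 : ∀ w : PlacesOver E v, toPlace v w ϖ ≠ 0)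
    (hα : ‖(((∏ w : PlacesOver E v, χ.localComponent w.1 (Units.mk0 (toPlace v w ϖ) (hϖ0 w))) : ℂˣ) : ℂ)‖ ≤ 1)
    (h : UnitaryGroup.localPi E c (1 + 1) JD v) :
    localIntertwining F E c v 1 hJD νN φ h =
      (νN.real {u | (u : UnitaryGroup.localPi E c (1 + 1) JD v) ∈ UnitaryGroup.localInt E c (1 + 1) JD v} : ℂ) *
        ((1 - ε.valueAtUniformizer v * (v.residueCard : ℂ) ^ (-(2 * z))) * (1 - ε.valueAtUniformizer v * (v.residueCard : ℂ) ^ (-(2 * z - 1)))⁻¹) * φ' h := by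
  have hs : 0 < (z - 1 / 2).re := by
    rw [Complex.sub_re, show (1 / 2 : ℂ).re = 1 / 2 by norm_num]
    linarith
  rw [localIntertwining_eq_aNorm_one_mul_of_re_pos F E v c hcδ hδ hd hT₀ hT₀d hJD νN (fun w => χ.localComponent w.1) χv' hχ' hs hφ hφ' h2 hT hTinv hδw hχ hϖ hϖ0 hα h,
    chiLocalScalar_eq_lF_div v χ ε hε hχ z, aNorm_one]

end Operator

end Summit.HodgeConjecture.HodgeConjecture.Cruxes.H413.K2E1ChiIntertwiningLocalScalarFromK2LiuU2

end
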